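import Literature.NumberTheory.EllipticCurves.Zywina2025RankTwo
import Literature.NumberTheory.EllipticCurves.KramerDescentLocalGeneratorsProofs
import Literature.NumberTheory.EllipticCurves.TwoIsogenySelmerGroup
import HarnessLib

set_option linter.dupNamespace false -- namespace `…BirchSwinnertonDyer.BirchSwinnertonDyer…` is the cell's (D-0017 nested layout)
set_option autoImplicit false

/-!
# LINE C3 (EVEN-TWIST LAW), file 1a: the `2`-ADIC half of the `2`-isogeny descent of the even partner
# `49a1^{(2p)}`, `p ≡ 5 (mod 8)` — a halving-descent engine in `ℤ₂` and the six `p`-classes killed at `2`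

Cell `bsd-goldfeld`, seat `bsd-goldfeld-s1p-c3x` (gen 7); planner ORDER «LINE C3» (ruling (ccxxi)); this is the mechanical
first half of C3-1 (the `400`-line cap forces the split; the Selmer orders and the rank/`Ш[2]`/corank consequences are file 1b
`…TwinEvenTwistDescent`). `--supports stmt-BirchSwinnertonDyer-19350` as a HELPER. Theses-free; theorems only
(no definition, no fact binder, no `sorry`); FACT-FREE; Literature imports only.

CONTENT. For the two-torsion model `E_{2p} : y² = x³ + 42p·x² + 448p²·x` of `49a1^{(2p)}` the `2`-isogeny homogeneous
spaces of the classes `p, 2p, 7p ∈ S(42p, 448p²)` and `p, 2p, −7p ∈ S(−84p, −28p²)` are `w² = p·Q(u,z)` with `Q` integral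
and INDEPENDENT of `p`. For `p ≡ 5 (mod 8)`, `5p ≡ 1 (mod 8)` is a square in `ℚ₂` (tree
`KramerLocal.padicTwo_isSquare_intCast`, Serre II.3.3), so `w² = p·Q` is `ℚ₂`-soluble iff `w² = 5·Q` is
(`isSoluble_two_five_of_fiveModEight`): ONE numeric quartic per class, uniformly in `p`. Each numeric quartic is refuted
in both `ℤ₂`-charts (`not_isSoluble_two_of_padicInt_charts`, from Zywina's `exists_padicInt_of_isSoluble`) by residues
(`padicInt_two_sq_ne_of_zmodPow`), the chart that would need a deep modulus being first shrunk by the HALVING DESCENT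
`padicInt_two_sq_ne_of_descend`: if `s² = e + a t² + e' t⁴` is impossible mod `2ᵏ` for odd `t` and `4 ∣ e`, a `ℤ₂`-solution
has `t = 2t₁`, `s = 2s₁`, `s₁² = e/4 + a t₁² + 4e' t₁⁴` — so every `decide` below runs in `ℤ/2ᵏ` with `k ≤ 6`
(`keys_*`; `decide +kernel` only at `k = 6`). Main statement: `not_isSoluble_two_twoPosTwist` (the six kills, for every
`p ≡ 5 (mod 8)`; no primality and no `(−7/p)` needed at the prime `2`). §3 records the residue facts at `p` and at `7`
used by file 1b (`2, 14, 32, 224, −14 ∉ 𝔽_p²`; `p ∈ {1,2,4} mod 7` and the non-residue table mod `7`).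

NUMERICS (kit j294319; evidence on item 19350): consistent — all `182` primes `p ≡ 5 (mod 8)`, `(p/7) = +1`, `p < 12000`
give `49a1^{(2p)}` of analytic rank `0` with ODD analytic `#Ш`. HONEST FRAMING: local `2`-adic algebra only; no Selmer
set, rank, Heegner point or `L`-value is touched here; no case of K12₂″ / twin″ is decided; BSD is not proved by any of this.

References: Silverman, *AEC* (2009), X.4.9–X.4.10 [SilvermanAEC2009]; Zywina, arXiv:2502.01957, Lemma 3.1 [Zywina2025];
Serre, *Cours d'arithmétique* II.3.3 Thm 4 [Serre1973].
-/

noncomputable section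

open scoped Classical

open Literature.NumberTheory.EllipticCurves
open Literature.NumberTheory.EllipticCurves.Zywina2025 (exists_padicInt_of_isSoluble)

namespace Summit.BirchSwinnertonDyer.BirchSwinnertonDyer.Theorems.GoldfeldGoodTwists

/-! ## §1. A `2`-adic engine: residues, halving descent, and the `5p ≡ 1 (mod 8)` normalisation -/

section TwoAdic

/-- Base case: if `S² = e + aT² + e'T⁴` has no solution in `ℤ/2ᵏ`, it has none in `ℤ₂`. [folklore] -/
theorem padicInt_two_sq_ne_of_zmodPow {e a e' : ℤ} (k : ℕ)
    (h : ∀ T S : ZMod (2 ^ k), S ^ 2 ≠ (e : ZMod (2 ^ k)) + (a : ZMod (2 ^ k)) * T ^ 2 + (e' : ZMod (2 ^ k)) * T ^ 4)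
    (t s : ℤ_[2]) : s ^ 2 ≠ (e : ℤ_[2]) + (a : ℤ_[2]) * t ^ 2 + (e' : ℤ_[2]) * t ^ 4 := by
  intro hs
  have h2 := congrArg (PadicInt.toZModPow k : ℤ_[2] →+* ZMod (2 ^ k)) hs
  simp only [map_pow, map_add, map_mul, map_intCast] at h2
  exact h _ _ h2

/-- In `ℤ₂`: `toZMod x = 0 ↔ 2 ∣ x`. [folklore] -/
private theorem toZMod_two_eq_zero_iff_dvd (x : ℤ_[2]) : PadicInt.toZMod x = 0 ↔ (2 : ℤ_[2]) ∣ x := by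
  rw [← RingHom.mem_ker, PadicInt.ker_toZMod, PadicInt.maximalIdeal_eq_span_p, Ideal.mem_span_singleton]
  norm_cast

/-- Parity in `ℤ₂`: every `t` is `2t₁` or `2t₁ + 1`. [folklore] -/
private theorem exists_eq_two_mul_or (t : ℤ_[2]) : ∃ t₁ : ℤ_[2], t = 2 * t₁ ∨ t = 2 * t₁ + 1 := by
  have hr : PadicInt.toZMod t = 0 ∨ PadicInt.toZMod t = 1 := by
    generalize PadicInt.toZMod t = r
    fin_cases r
    · exact Or.inl rfl
    · exact Or.inr rfl
  rcases hr with h0 | h1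
  · obtain ⟨t₁, ht⟩ := (toZMod_two_eq_zero_iff_dvd t).mp h0
    exact ⟨t₁, Or.inl ht⟩
  · have h0 : PadicInt.toZMod (t - 1) = 0 := by rw [map_sub, map_one, h1, sub_self]
    obtain ⟨t₁, ht⟩ := (toZMod_two_eq_zero_iff_dvd (t - 1)).mp h0
    exact ⟨t₁, Or.inr (by linear_combination ht)⟩

/-- **Halving descent.** If `s² = e + a t² + e' t⁴` is impossible in `ℤ/2ᵏ` for ODD `t`, and `e = 4e₁`, then a
`ℤ₂`-solution has `t = 2t₁`, `s = 2s₁` with `s₁² = e₁ + a t₁² + 4e' t₁⁴`; so the absence of solutions of the halved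
equation gives the absence of solutions of the original one. [folklore] -/
theorem padicInt_two_sq_ne_of_descend {e a e' : ℤ} (e₁ : ℤ) (k : ℕ) (he : e = 4 * e₁)
    (hodd : ∀ T S : ZMod (2 ^ k),
      S ^ 2 ≠ (e : ZMod (2 ^ k)) + (a : ZMod (2 ^ k)) * (2 * T + 1) ^ 2 + (e' : ZMod (2 ^ k)) * (2 * T + 1) ^ 4)
    (hrec : ∀ t s : ℤ_[2], s ^ 2 ≠ (e₁ : ℤ_[2]) + (a : ℤ_[2]) * t ^ 2 + ((4 * e' : ℤ) : ℤ_[2]) * t ^ 4)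
    (t s : ℤ_[2]) : s ^ 2 ≠ (e : ℤ_[2]) + (a : ℤ_[2]) * t ^ 2 + (e' : ℤ_[2]) * t ^ 4 := by
  intro hs
  obtain ⟨t₁, ht | ht⟩ := exists_eq_two_mul_or t
  · -- `t` even: halve
    subst ht
    have hpp : Prime (2 : ℤ_[2]) := PadicInt.prime_p
    have hs' : s ^ 2 = 4 * ((e₁ : ℤ_[2]) + (a : ℤ_[2]) * t₁ ^ 2 + 4 * (e' : ℤ_[2]) * t₁ ^ 4) := by
      rw [hs, he]; push_cast; ring
    have h2s : (2 : ℤ_[2]) ∣ s ^ 2 := ⟨2 * ((e₁ : ℤ_[2]) + (a : ℤ_[2]) * t₁ ^ 2 + 4 * (e' : ℤ_[2]) * t₁ ^ 4),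
      by rw [hs']; ring⟩
    obtain ⟨s₁, rfl⟩ := hpp.dvd_of_dvd_pow h2s
    refine hrec t₁ s₁ ?_
    have h4 : (4 : ℤ_[2]) ≠ 0 := by norm_num
    have := mul_left_cancel₀ h4 (show (4 : ℤ_[2]) * s₁ ^ 2 =
      4 * ((e₁ : ℤ_[2]) + (a : ℤ_[2]) * t₁ ^ 2 + 4 * (e' : ℤ_[2]) * t₁ ^ 4) by rw [← hs']; ring)
    rw [this]; push_cast; ring
  · -- `t` odd: residues
    subst ht
    have h2 := congrArg (PadicInt.toZModPow k : ℤ_[2] →+* ZMod (2 ^ k)) hs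
    simp only [map_pow, map_add, map_mul, map_intCast, map_ofNat, map_one] at h2
    exact hodd _ _ h2

/-- Charts: if both affine `ℤ₂`-charts `s² = d + a t² + d' t⁴` and `s² = d' + a t² + d t⁴` are impossible, the
homogeneous space `w² = d u⁴ + a u²z² + d' z⁴` has no non-trivial `ℚ₂`-point. [cite: SilvermanAEC2009, Prop. X.4.9] -/
theorem not_isSoluble_two_of_padicInt_charts {a d d' : ℤ}
    (hA : ∀ t s : ℤ_[2], s ^ 2 ≠ (d : ℤ_[2]) + (a : ℤ_[2]) * t ^ 2 + (d' : ℤ_[2]) * t ^ 4)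
    (hB : ∀ t s : ℤ_[2], s ^ 2 ≠ (d' : ℤ_[2]) + (a : ℤ_[2]) * t ^ 2 + (d : ℤ_[2]) * t ^ 4) :
    ¬ ((twoIsogenyQuartic a d d').map (Int.castRingHom ℚ_[2])).IsSoluble := by
  intro h
  obtain ⟨f, f', hff, t, s, hs⟩ := exists_padicInt_of_isSoluble h
  rcases hff with ⟨rfl, rfl⟩ | ⟨rfl, rfl⟩
  · exact hA t s hs
  · exact hB t s hs

/-- **The `5p ≡ 1 (mod 8)` normalisation.** For `p ≡ 5 (mod 8)`, `5p` is a square in `ℚ₂`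
(`KramerLocal.padicTwo_isSquare_intCast`), so a `ℚ₂`-point of `w² = p·(d₀u⁴ + a₀u²z² + e₀z⁴)` yields one of
`w² = 5·(d₀u⁴ + a₀u²z² + e₀z⁴)` (`w ↦ 5w/√(5p)`): the `p`-classes of the descent reduce to ONE numeric quartic each.
[cite: Serre1973, Ch. II §3.3 Thm 4] -/
theorem isSoluble_two_five_of_fiveModEight {p : ℕ} (hp8 : p % 8 = 5) {a d d' a₀ d₀ e₀ : ℤ}
    (ha : a = p * a₀) (hd : d = p * d₀) (hd' : d' = p * e₀)
    (h : ((twoIsogenyQuartic a d d').map (Int.castRingHom ℚ_[2])).IsSoluble) :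
    ((twoIsogenyQuartic (5 * a₀) (5 * d₀) (5 * e₀)).map (Int.castRingHom ℚ_[2])).IsSoluble := by
  obtain ⟨x, y, w, h0, hw⟩ := h
  rw [eval_map_twoIsogenyQuartic] at hw
  simp only [eq_intCast] at hw
  subst ha hd hd'
  push_cast at hw
  have h8 : (8 : ℤ) ∣ 5 * (p : ℤ) - 1 := by omega
  obtain ⟨v, hv⟩ := KramerLocal.padicTwo_isSquare_intCast h8
  push_cast at hv
  have hp0 : (p : ℚ_[2]) ≠ 0 := by exact_mod_cast (show p ≠ 0 by omega)
  have hv0 : v ≠ 0 := by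
    rintro rfl
    exact hp0 (by simpa using hv)
  refine ⟨x, y, 5 * w / v, h0, ?_⟩
  rw [eval_map_twoIsogenyQuartic]
  simp only [eq_intCast]
  push_cast
  rw [div_pow, div_eq_iff (pow_ne_zero 2 hv0)]
  linear_combination (25 : ℚ_[2]) * hw +
    5 * ((d₀ : ℚ_[2]) * x ^ 4 + (a₀ : ℚ_[2]) * x ^ 2 * y ^ 2 + (e₀ : ℚ_[2]) * y ^ 4) * hv

end TwoAdic

/-! ## §2. The six `2`-adic kills, after normalisation to `p = 5` -/

section Keys

/-- `ℤ/2ᵏ` keys for the class `p ∈ S` (normalised quartic `(a, d, d') = (210, 5, 2240)`): chart `u = 1` mod `8`;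
chart `z = 1` after two halvings (`2240 = 4·560`, `560 = 4·140`) mod `32`. [folklore] -/
private theorem keys_S_one :
    (∀ T S : ZMod (2 ^ 3), S ^ 2 ≠ ((5 : ℤ) : ZMod (2 ^ 3)) + ((210 : ℤ) : ZMod (2 ^ 3)) * T ^ 2 +
      ((2240 : ℤ) : ZMod (2 ^ 3)) * T ^ 4) ∧
    (∀ T S : ZMod (2 ^ 2), S ^ 2 ≠ ((2240 : ℤ) : ZMod (2 ^ 2)) + ((210 : ℤ) : ZMod (2 ^ 2)) * (2 * T + 1) ^ 2 +
      ((5 : ℤ) : ZMod (2 ^ 2)) * (2 * T + 1) ^ 4) ∧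
    (∀ T S : ZMod (2 ^ 2), S ^ 2 ≠ ((560 : ℤ) : ZMod (2 ^ 2)) + ((210 : ℤ) : ZMod (2 ^ 2)) * (2 * T + 1) ^ 2 +
      ((4 * 5 : ℤ) : ZMod (2 ^ 2)) * (2 * T + 1) ^ 4) ∧
    (∀ T S : ZMod (2 ^ 5), S ^ 2 ≠ ((140 : ℤ) : ZMod (2 ^ 5)) + ((210 : ℤ) : ZMod (2 ^ 5)) * T ^ 2 +
      ((4 * (4 * 5) : ℤ) : ZMod (2 ^ 5)) * T ^ 4) := by
  refine ⟨?_, ?_, ?_, ?_⟩ <;> decide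

/-- `ℤ/2ᵏ` keys for the class `2p ∈ S` (normalised `(210, 10, 1120)`): chart `u = 1` mod `16`; chart `z = 1` after one
halving (`1120 = 4·280`) mod `64`. [folklore] -/
private theorem keys_S_two :
    (∀ T S : ZMod (2 ^ 4), S ^ 2 ≠ ((10 : ℤ) : ZMod (2 ^ 4)) + ((210 : ℤ) : ZMod (2 ^ 4)) * T ^ 2 +
      ((1120 : ℤ) : ZMod (2 ^ 4)) * T ^ 4) ∧
    (∀ T S : ZMod (2 ^ 4), S ^ 2 ≠ ((1120 : ℤ) : ZMod (2 ^ 4)) + ((210 : ℤ) : ZMod (2 ^ 4)) * (2 * T + 1) ^ 2 +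
      ((10 : ℤ) : ZMod (2 ^ 4)) * (2 * T + 1) ^ 4) ∧
    (∀ T S : ZMod (2 ^ 6), S ^ 2 ≠ ((280 : ℤ) : ZMod (2 ^ 6)) + ((210 : ℤ) : ZMod (2 ^ 6)) * T ^ 2 +
      ((4 * 10 : ℤ) : ZMod (2 ^ 6)) * T ^ 4) := by
  refine ⟨?_, ?_, ?_⟩
  · decide
  · decide
  · decide +kernel

/-- `ℤ/2ᵏ` keys for the class `7p ∈ S` (normalised `(210, 35, 320)`): chart `u = 1` mod `8`; chart `z = 1` after two
halvings (`320 = 4·80`, `80 = 4·20`) mod `32`. [folklore] -/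
private theorem keys_S_seven :
    (∀ T S : ZMod (2 ^ 3), S ^ 2 ≠ ((35 : ℤ) : ZMod (2 ^ 3)) + ((210 : ℤ) : ZMod (2 ^ 3)) * T ^ 2 +
      ((320 : ℤ) : ZMod (2 ^ 3)) * T ^ 4) ∧
    (∀ T S : ZMod (2 ^ 3), S ^ 2 ≠ ((320 : ℤ) : ZMod (2 ^ 3)) + ((210 : ℤ) : ZMod (2 ^ 3)) * (2 * T + 1) ^ 2 +
      ((35 : ℤ) : ZMod (2 ^ 3)) * (2 * T + 1) ^ 4) ∧
    (∀ T S : ZMod (2 ^ 2), S ^ 2 ≠ ((80 : ℤ) : ZMod (2 ^ 2)) + ((210 : ℤ) : ZMod (2 ^ 2)) * (2 * T + 1) ^ 2 +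
      ((4 * 35 : ℤ) : ZMod (2 ^ 2)) * (2 * T + 1) ^ 4) ∧
    (∀ T S : ZMod (2 ^ 5), S ^ 2 ≠ ((20 : ℤ) : ZMod (2 ^ 5)) + ((210 : ℤ) : ZMod (2 ^ 5)) * T ^ 2 +
      ((4 * (4 * 35) : ℤ) : ZMod (2 ^ 5)) * T ^ 4) := by
  refine ⟨?_, ?_, ?_, ?_⟩ <;> decide

/-- `ℤ/2ᵏ` keys for the class `p ∈ S'` (normalised `(−420, 5, −140)`): both charts directly (mod `8`, mod `32`). [folklore] -/
private theorem keys_S'_one :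
    (∀ T S : ZMod (2 ^ 3), S ^ 2 ≠ ((5 : ℤ) : ZMod (2 ^ 3)) + ((-420 : ℤ) : ZMod (2 ^ 3)) * T ^ 2 +
      ((-140 : ℤ) : ZMod (2 ^ 3)) * T ^ 4) ∧
    (∀ T S : ZMod (2 ^ 5), S ^ 2 ≠ ((-140 : ℤ) : ZMod (2 ^ 5)) + ((-420 : ℤ) : ZMod (2 ^ 5)) * T ^ 2 +
      ((5 : ℤ) : ZMod (2 ^ 5)) * T ^ 4) := by
  refine ⟨?_, ?_⟩ <;> decide

/-- `ℤ/2ᵏ` keys for the class `2p ∈ S'` (normalised `(−420, 10, −70)`): both charts mod `64`. [folklore] -/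
private theorem keys_S'_two :
    (∀ T S : ZMod (2 ^ 6), S ^ 2 ≠ ((10 : ℤ) : ZMod (2 ^ 6)) + ((-420 : ℤ) : ZMod (2 ^ 6)) * T ^ 2 +
      ((-70 : ℤ) : ZMod (2 ^ 6)) * T ^ 4) ∧
    (∀ T S : ZMod (2 ^ 6), S ^ 2 ≠ ((-70 : ℤ) : ZMod (2 ^ 6)) + ((-420 : ℤ) : ZMod (2 ^ 6)) * T ^ 2 +
      ((10 : ℤ) : ZMod (2 ^ 6)) * T ^ 4) := by
  refine ⟨?_, ?_⟩ <;> decide +kernel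

/-- `ℤ/2ᵏ` keys for the class `−7p ∈ S'` (normalised `(−420, −35, 20)`): both charts directly (mod `8`, mod `32`). [folklore] -/
private theorem keys_S'_negSeven :
    (∀ T S : ZMod (2 ^ 3), S ^ 2 ≠ ((-35 : ℤ) : ZMod (2 ^ 3)) + ((-420 : ℤ) : ZMod (2 ^ 3)) * T ^ 2 +
      ((20 : ℤ) : ZMod (2 ^ 3)) * T ^ 4) ∧
    (∀ T S : ZMod (2 ^ 5), S ^ 2 ≠ ((20 : ℤ) : ZMod (2 ^ 5)) + ((-420 : ℤ) : ZMod (2 ^ 5)) * T ^ 2 +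
      ((-35 : ℤ) : ZMod (2 ^ 5)) * T ^ 4) := by
  refine ⟨?_, ?_⟩ <;> decide

/-- **The six normalised `2`-adic kills**: the quartics `(210; 5, 2240)`, `(210; 10, 1120)`, `(210; 35, 320)` and
`(−420; 5, −140)`, `(−420; 10, −70)`, `(−420; −35, 20)` have no non-trivial `ℚ₂`-point.
[cite: SilvermanAEC2009, Prop. X.4.9 and Example X.4.10] -/
theorem not_isSoluble_two_normalised_twoPosTwist :
    ¬ ((twoIsogenyQuartic 210 5 2240).map (Int.castRingHom ℚ_[2])).IsSoluble ∧
    ¬ ((twoIsogenyQuartic 210 10 1120).map (Int.castRingHom ℚ_[2])).IsSoluble ∧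
    ¬ ((twoIsogenyQuartic 210 35 320).map (Int.castRingHom ℚ_[2])).IsSoluble ∧
    ¬ ((twoIsogenyQuartic (-420) 5 (-140)).map (Int.castRingHom ℚ_[2])).IsSoluble ∧
    ¬ ((twoIsogenyQuartic (-420) 10 (-70)).map (Int.castRingHom ℚ_[2])).IsSoluble ∧
    ¬ ((twoIsogenyQuartic (-420) (-35) 20).map (Int.castRingHom ℚ_[2])).IsSoluble := by
  obtain ⟨a1, b1, b1', b1''⟩ := keys_S_one
  obtain ⟨a2, b2, b2'⟩ := keys_S_two
  obtain ⟨a7, b7, b7', b7''⟩ := keys_S_seven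
  obtain ⟨c1, c1'⟩ := keys_S'_one
  obtain ⟨c2, c2'⟩ := keys_S'_two
  obtain ⟨c7, c7'⟩ := keys_S'_negSeven
  refine ⟨?_, ?_, ?_, ?_, ?_, ?_⟩
  · exact not_isSoluble_two_of_padicInt_charts (padicInt_two_sq_ne_of_zmodPow 3 a1)
      (padicInt_two_sq_ne_of_descend 560 2 (by norm_num) b1
        (padicInt_two_sq_ne_of_descend 140 2 (by norm_num) b1' (padicInt_two_sq_ne_of_zmodPow 5 b1'')))
  · exact not_isSoluble_two_of_padicInt_charts (padicInt_two_sq_ne_of_zmodPow 4 a2)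
      (padicInt_two_sq_ne_of_descend 280 4 (by norm_num) b2 (padicInt_two_sq_ne_of_zmodPow 6 b2'))
  · exact not_isSoluble_two_of_padicInt_charts (padicInt_two_sq_ne_of_zmodPow 3 a7)
      (padicInt_two_sq_ne_of_descend 80 3 (by norm_num) b7
        (padicInt_two_sq_ne_of_descend 20 2 (by norm_num) b7' (padicInt_two_sq_ne_of_zmodPow 5 b7'')))
  · exact not_isSoluble_two_of_padicInt_charts (padicInt_two_sq_ne_of_zmodPow 3 c1)
      (padicInt_two_sq_ne_of_zmodPow 5 c1')
  · exact not_isSoluble_two_of_padicInt_charts (padicInt_two_sq_ne_of_zmodPow 6 c2)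
      (padicInt_two_sq_ne_of_zmodPow 6 c2')
  · exact not_isSoluble_two_of_padicInt_charts (padicInt_two_sq_ne_of_zmodPow 3 c7)
      (padicInt_two_sq_ne_of_zmodPow 5 c7')

end Keys

/-- **`2`-adic lemma for `E_{2p}`, `p ≡ 5 (mod 8)`**: the classes `p, 2p, 7p` of `S(42p, 448p²)` and `p, 2p, −7p` of
`S(−84p, −28p²)` have no `ℚ₂`-point (normalisation `5p ∈ ℚ₂²` + the six numeric kills).
[cite: SilvermanAEC2009, Prop. X.4.9 and Example X.4.10] [cite: Serre1973, Ch. II §3.3 Thm 4] -/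
theorem not_isSoluble_two_twoPosTwist {p : ℕ} (hp8 : p % 8 = 5) :
    ¬ ((twoIsogenyQuartic (42 * p) ((p : ℤ) * 1) ((p : ℤ) * 448)).map (Int.castRingHom ℚ_[2])).IsSoluble ∧
    ¬ ((twoIsogenyQuartic (42 * p) ((p : ℤ) * 2) ((p : ℤ) * 224)).map (Int.castRingHom ℚ_[2])).IsSoluble ∧
    ¬ ((twoIsogenyQuartic (42 * p) ((p : ℤ) * 7) ((p : ℤ) * 64)).map (Int.castRingHom ℚ_[2])).IsSoluble ∧
    ¬ ((twoIsogenyQuartic (-84 * p) ((p : ℤ) * 1) ((p : ℤ) * (-28))).map (Int.castRingHom ℚ_[2])).IsSoluble ∧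
    ¬ ((twoIsogenyQuartic (-84 * p) ((p : ℤ) * 2) ((p : ℤ) * (-14))).map (Int.castRingHom ℚ_[2])).IsSoluble ∧
    ¬ ((twoIsogenyQuartic (-84 * p) ((p : ℤ) * (-7)) ((p : ℤ) * 4)).map (Int.castRingHom ℚ_[2])).IsSoluble := by
  obtain ⟨k1, k2, k3, k4, k5, k6⟩ := not_isSoluble_two_normalised_twoPosTwist
  have ha : (42 * p : ℤ) = p * 42 := by ring
  have ha' : (-84 * p : ℤ) = p * (-84) := by ring
  refine ⟨fun h => k1 ?_, fun h => k2 ?_, fun h => k3 ?_, fun h => k4 ?_, fun h => k5 ?_, fun h => k6 ?_⟩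
  · have h5 := isSoluble_two_five_of_fiveModEight hp8 ha rfl rfl h; norm_num at h5; exact h5
  · have h5 := isSoluble_two_five_of_fiveModEight hp8 ha rfl rfl h; norm_num at h5; exact h5
  · have h5 := isSoluble_two_five_of_fiveModEight hp8 ha rfl rfl h; norm_num at h5; exact h5
  · have h5 := isSoluble_two_five_of_fiveModEight hp8 ha' rfl rfl h; norm_num at h5; exact h5
  · have h5 := isSoluble_two_five_of_fiveModEight hp8 ha' rfl rfl h; norm_num at h5; exact h5
  · have h5 := isSoluble_two_five_of_fiveModEight hp8 ha' rfl rfl h; norm_num at h5; exact h5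

/-! ## §3. Residues at `p` and at `7` (for file 1b) -/

/-- For `p ≡ 5 (mod 8)` split: `2, 14, 32, 224, −14` are non-residues mod `p`. [folklore] -/
theorem residues_mod_p_fiveModEight {p : ℕ} [Fact p.Prime] (hp8 : p % 8 = 5)
    (hp7 : legendreSym p (-7) = 1) :
    ¬ IsSquare ((2 : ℤ) : ZMod p) ∧ ¬ IsSquare ((14 : ℤ) : ZMod p) ∧ ¬ IsSquare ((32 : ℤ) : ZMod p) ∧
      ¬ IsSquare ((224 : ℤ) : ZMod p) ∧ ¬ IsSquare ((-14 : ℤ) : ZMod p) := by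
  have hp2 : p ≠ 2 := by rintro rfl; norm_num at hp8
  have h2 : legendreSym p 2 = -1 := by
    rw [legendreSym.at_two hp2, ZMod.χ₈_nat_eq_if_mod_eight]
    simp [hp8, show p % 2 = 1 by omega]
  have hm1 : legendreSym p (-1) = 1 := by
    rw [legendreSym.at_neg_one hp2, ZMod.χ₄_nat_one_mod_four (by omega)]
  have h7 : legendreSym p 7 = 1 := by
    have hmul : legendreSym p (-7) = legendreSym p (-1) * legendreSym p 7 := by
      rw [← legendreSym.mul]; norm_num
    rw [hmul, hm1, one_mul] at hp7
    exact hp7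
  have h20 : ((2 : ℤ) : ZMod p) ≠ 0 := by
    intro h
    have : ((2 : ℕ) : ZMod p) = 0 := by exact_mod_cast h
    rw [ZMod.natCast_eq_zero_iff] at this
    exact hp2 ((Nat.prime_dvd_prime_iff_eq Fact.out Nat.prime_two).mp this)
  have h40 : ((4 : ℤ) : ZMod p) ≠ 0 := by
    have : ((4 : ℤ) : ZMod p) = ((2 : ℤ) : ZMod p) * ((2 : ℤ) : ZMod p) := by push_cast; norm_num
    rw [this]; exact mul_ne_zero h20 h20
  have h16 : legendreSym p 16 = 1 := by
    rw [show (16 : ℤ) = 4 ^ 2 by norm_num]; exact legendreSym.sq_one' p h40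
  have h14 : legendreSym p 14 = -1 := by
    rw [show (14 : ℤ) = 2 * 7 by norm_num, legendreSym.mul, h2, h7]; norm_num
  refine ⟨(legendreSym.eq_neg_one_iff p).mp h2, (legendreSym.eq_neg_one_iff p).mp h14,
    (legendreSym.eq_neg_one_iff p).mp ?_, (legendreSym.eq_neg_one_iff p).mp ?_,
    (legendreSym.eq_neg_one_iff p).mp ?_⟩
  · rw [show (32 : ℤ) = 16 * 2 by norm_num, legendreSym.mul, h16, h2]; norm_num
  · rw [show (224 : ℤ) = 16 * 14 by norm_num, legendreSym.mul, h16, h14]; norm_num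
  · rw [show (-14 : ℤ) = -1 * 14 by norm_num, legendreSym.mul, hm1, h14]; norm_num

/-- The nonzero squares mod `7` are `1, 2, 4`. [folklore] -/
theorem zmod_seven_square_cases' : ∀ q : ZMod 7, q ≠ 0 → (q * q = 1 ∨ q * q = 2 ∨ q * q = 4) := by
  decide

/-- Non-residue table mod `7` for a nonzero square `x`: `−1, −2, −x, −2x, −4x, −4x², −2x²` are non-squares. [folklore] -/
theorem zmod_seven_table' : ∀ x : ZMod 7, (x = 1 ∨ x = 2 ∨ x = 4) →
    ∀ r : ZMod 7, r * r ≠ -1 ∧ r * r ≠ -2 ∧ r * r ≠ -x ∧ r * r ≠ -2 * x ∧ r * r ≠ -4 * x ∧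
      r * r ≠ -4 * x ^ 2 ∧ r * r ≠ -2 * x ^ 2 := by
  decide

/-- A split prime `p ≡ 1 (mod 4)`, `p ≠ 7`, is a nonzero square mod `7` (reciprocity). [folklore] -/
theorem p_square_mod_seven {p : ℕ} [Fact p.Prime] (hp4 : p % 4 = 1) (hp7 : legendreSym p (-7) = 1)
    (hp7' : p ≠ 7) : (p : ZMod 7) ≠ 0 ∧ ((p : ZMod 7) = 1 ∨ (p : ZMod 7) = 2 ∨ (p : ZMod 7) = 4) := by
  haveI : Fact (Nat.Prime 7) := ⟨by norm_num⟩
  have hp2 : p ≠ 2 := by rintro rfl; norm_num at hp4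
  have hp07 : ((p : ℤ) : ZMod 7) ≠ 0 := by
    rw [Ne, ZMod.intCast_zmod_eq_zero_iff_dvd]
    intro h
    exact hp7' ((Nat.prime_dvd_prime_iff_eq (by norm_num) Fact.out).mp (by exact_mod_cast h)).symm
  have h7 : legendreSym p 7 = 1 := by
    have hm1 : legendreSym p (-1) = 1 := by
      rw [legendreSym.at_neg_one hp2, ZMod.χ₄_nat_one_mod_four hp4]
    have hmul : legendreSym p (-7) = legendreSym p (-1) * legendreSym p 7 := by
      rw [← legendreSym.mul]; norm_num
    rw [hmul, hm1, one_mul] at hp7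
    exact hp7
  have h7p : legendreSym 7 p = 1 := by
    rw [legendreSym.quadratic_reciprocity_one_mod_four hp4 (by norm_num)]; exact_mod_cast h7
  obtain ⟨q, hq⟩ := (legendreSym.eq_one_iff 7 hp07).mp h7p
  push_cast at hq hp07
  have hq0 : q ≠ 0 := by rintro rfl; apply hp07; rw [hq]; ring
  refine ⟨hp07, ?_⟩
  rw [hq]
  exact zmod_seven_square_cases' q hq0

end Summit.BirchSwinnertonDyer.BirchSwinnertonDyer.Theorems.GoldfeldGoodTwists

end
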